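import Literature.NumberTheory.PAdicHodge.BmaxPlusRemainder
import Literature.NumberTheory.PAdicHodge.BmaxPlusFrobeniusImage
import HarnessLib

/-!
# The kernel of `θ ∘ φᵐ` on `A_max`: divisibility by `ξ_m = [ϖ^{1/pᵐ}] − p` up to the factors `p` and `[ϖ^{1/pᵐ}]`

Topic `Literature/NumberTheory/PAdicHodge`; namespace `Literature.NumberTheory.PAdicHodge`. THEOREMS ONLY (no definition, no named
fact, no instance). Continuation of `BmaxPlusRemainder` / `BmaxPlusFrobeniusImage` on Colmez's `A_max = B_max⁺(F)` (`BmaxPlus`;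
`T = ξ/p = omegaB`, `ω' = T + 1 = [p♭]/p`, `ι : 𝔸_inf → A_max`, `θ = thetaBmaxPlus`, `φ = frobBmaxPlus`). Fix `m` and a `pᵐ`-th root
`ϖ_m` of `p♭` in `𝒪_{ℂ_F}♭`; put `π_m = [ϖ_m]` and `ξ_m = π_m − p` (so `φᵐ(ξ_m) = ξ` and `ker(θ∘φᵐ|𝔸_inf) = ξ_m·𝔸_inf`).

* `natCast_mul_omegaB_add_one_sub_eq`, `teichmuller_mul_omegaB_add_one_sub_eq` — the two identities
  **`p·(ω' − p^{pᵐ−1}) = ι(ξ_m)·ι(Ψ')`** and **`ι(π_m)·(ω' − p^{pᵐ−1}) = ι(ξ_m)·Ψ`** (geometric sums: `π_m^{pᵐ} = [p♭] = p·ω'`);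
  hence `theta_frobenius_iterate_omegaB_add_one_sub` — **`θ(φᵐ(ω' − p^{pᵐ−1})) = 0`**.
* ★ `exists_eq_of_theta_frobenius_iterate_eq_zero` — **structure of `ker(θ∘φᵐ|A_max)`**: if `θ(φᵐ g) = 0` then
  `g = ι(ξ_m·b) + (ω' − p^{pᵐ−1})·G` (division with remainder by `ω' − p^{pᵐ−1}`, `BmaxPlusRemainder`, plus `ker(θ∘φᵐ|𝔸_inf) = ξ_m𝔸_inf`).
* ★ `exists_natCast_mul_eq_of_theta_frobenius_iterate_eq_zero` — **`p·g ∈ ι(ξ_m)·A_max`**, and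
  ★ `exists_teichmuller_mul_eq_of_theta_frobenius_iterate_eq_zero` — **`ι(π_m)·g ∈ ι(ξ_m)·A_max`**, for every such `g`
  (the ideal `ker(θ∘φᵐ|A_max) = (ξ_m, ω' − [ϖ_m]^{pᵐ−1})` is not principal; these are the two sharp divisibilities).

Step (Dec_m)/(i)/(ii) of the `t`-divisibility theorem (TDIV) for `(A_max)^{φ=p} ∩ ker θ` (brick B7 of the φ-road of line `kato_lever`,
crux K★ `stmt-BirchSwinnertonDyer-22226`, memo `Cruxes/StarredOptimalManinUnitFiveSeven/Lines/kato-lever-K2-fontaine-lemma-g24.md`).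
Infrastructure only: BSD / K★ are not proved by any of this.

## References
* [Colmez1998Annals] P. Colmez, *Théorie d'Iwasawa des représentations de de Rham d'un corps local*, Ann. of Math. 148 (1998), §III.2–III.3
  (`A_max`, the points `θ∘φⁿ`, `t`-divisibility).
* [FontaineAsterisque223III] J.-M. Fontaine, *Le corps des périodes p-adiques*, Astérisque 223 (1994), Exp. III §5.1–5.3 (`I^{[r]}`).
-/

noncomputable section

open WittVector Field ValuativeRel Polynomial Finset
open Literature.AlgebraicGeometry.Resolution

namespace Literature.NumberTheory.PAdicHodge

open Literature.NumberTheory.GaloisRepresentations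
open Literature.NumberTheory.GaloisRepresentations.IsNonarchimedeanLocalField

variable {F : Type} [Field F] [ValuativeRel F] [TopologicalSpace F] [IsNonarchimedeanLocalField F]
  [CharZero F] {p : ℕ} [Fact p.Prime] [Fact (¬ IsUnit (p : integerC F))]
  [IsAdicComplete (Ideal.span {(p : integerC F)}) (integerC F)]

/-! ### `θ ∘ φᵐ` on the image of `𝔸_inf` -/

omit [CharZero F] [IsAdicComplete (Ideal.span {(p : integerC F)}) (integerC F)] in
/-- `φᵐ ∘ ι = ι ∘ φᵐ` on `𝔸_inf → A_max`. [cite: Colmez1998Annals, §III.2] -/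
theorem frobBmaxPlus_iterate_ainfToBmaxPlus (m : ℕ) (a : Ainf (p := p) F) :
    (frobBmaxPlus F p)^[m] (ainfToBmaxPlus F p a) =
      ainfToBmaxPlus F p ((WittVector.frobenius : Ainf (p := p) F →+* Ainf (p := p) F)^[m] a) := by
  induction m with
  | zero => rfl
  | succ m ih => rw [Function.iterate_succ_apply', Function.iterate_succ_apply', ih, frobBmaxPlus_ainfToBmaxPlus]

set_option maxHeartbeats 1600000 in
set_option synthInstance.maxHeartbeats 400000 in
omit [CharZero F] [IsAdicComplete (Ideal.span {(p : integerC F)}) (integerC F)] in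
/-- `φᵐ(n) = n` on `A_max` (`φ` is a ring endomorphism). [cite: FontaineAsterisque223III, Exp. II §1.1] -/
theorem frobBmaxPlus_iterate_natCast (m n : ℕ) : (frobBmaxPlus F p)^[m] (n : BmaxPlus F p) = n := by
  induction m with
  | zero => rfl
  | succ m ih => rw [Function.iterate_succ_apply', ih, map_natCast]

/-- **`θ(φᵐ(ι a)) = θ(φᵐ a)`.** [cite: Colmez1998Annals, §III.2] -/
theorem thetaBmaxPlus_frobBmaxPlus_iterate_ainfToBmaxPlus (m : ℕ) (a : Ainf (p := p) F) :
    thetaBmaxPlus F p ((frobBmaxPlus F p)^[m] (ainfToBmaxPlus F p a)) =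
      fontaineTheta (integerC F) p ((WittVector.frobenius : Ainf (p := p) F →+* Ainf (p := p) F)^[m] a) := by
  rw [frobBmaxPlus_iterate_ainfToBmaxPlus, thetaBmaxPlus_ainfToBmaxPlus]

/-! ### `ξ_m = [ϖ_m] − p` with `ϖ_m^{pᵐ} = p♭` -/

omit [CharZero F] [IsAdicComplete (Ideal.span {(p : integerC F)}) (integerC F)] in
/-- `φᵐ[x] = [x^{pᵐ}] = [x]^{pᵐ}` for Teichmüller representatives in `𝕎(𝒪♭)`. [cite: FontaineAsterisque223III, Exp. II §1.1] -/
theorem frobenius_iterate_teichmuller (m : ℕ) (x : PreTilt (integerC F) p) :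
    (WittVector.frobenius : Ainf (p := p) F →+* Ainf (p := p) F)^[m] (teichmuller p x) = teichmuller p x ^ p ^ m := by
  induction m with
  | zero => rw [Function.iterate_zero, id, pow_zero, pow_one]
  | succ m ih =>
    rw [Function.iterate_succ_apply', ih, map_pow, frobenius_teichmuller, ← pow_mul, ← pow_succ']

omit [CharZero F] [IsAdicComplete (Ideal.span {(p : integerC F)}) (integerC F)] in
/-- `φᵐ(n) = n` on `𝔸_inf` (`φ` is a ring endomorphism). [cite: FontaineAsterisque223III, Exp. II §1.1] -/
theorem frobenius_iterate_natCast (m n : ℕ) :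
    (WittVector.frobenius : Ainf (p := p) F →+* Ainf (p := p) F)^[m] (n : Ainf (p := p) F) = n := by
  induction m with
  | zero => rfl
  | succ m ih => rw [Function.iterate_succ_apply', ih, map_natCast]

omit [CharZero F] [IsAdicComplete (Ideal.span {(p : integerC F)}) (integerC F)] in
/-- **`φᵐ([ϖ_m] − p) = ξ`** when `ϖ_m^{pᵐ} = p♭`. [cite: Colmez1998Annals, §III.2] -/
theorem frobenius_iterate_teichmuller_sub_natCast {m : ℕ} {ϖm : PreTilt (integerC F) p} (hϖ : ϖm ^ p ^ m = pFlat) :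
    (WittVector.frobenius : Ainf (p := p) F →+* Ainf (p := p) F)^[m] (teichmuller p ϖm - (p : Ainf (p := p) F)) = xi := by
  rw [iterate_map_sub, frobenius_iterate_teichmuller, ← map_pow, hϖ, xi_def, frobenius_iterate_natCast]

set_option maxHeartbeats 1600000 in
set_option synthInstance.maxHeartbeats 400000 in
/-- **`θ(φᵐ(ι ξ_m)) = θ(ξ) = 0`.** [cite: Colmez1998Annals, §III.2] -/
theorem thetaBmaxPlus_frobBmaxPlus_iterate_xiM {m : ℕ} {ϖm : PreTilt (integerC F) p} (hϖ : ϖm ^ p ^ m = pFlat) :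
    thetaBmaxPlus F p ((frobBmaxPlus F p)^[m] (ainfToBmaxPlus F p (teichmuller p ϖm - (p : Ainf (p := p) F)))) = 0 := by
  rw [thetaBmaxPlus_frobBmaxPlus_iterate_ainfToBmaxPlus, frobenius_iterate_teichmuller_sub_natCast hϖ, fontaineTheta_xi]

/-- **`ker(θ∘φᵐ|𝔸_inf) = ξ_m·𝔸_inf`**: if `θ(φᵐ a) = 0` then `a = ξ_m·b` (`ker θ = ξ𝔸_inf` and `φ` is bijective on `𝕎(𝒪♭)`).
[cite: Colmez1998Annals, §III.2] -/
theorem exists_eq_xiM_mul_of_fontaineTheta_frobenius_iterate_eq_zero {m : ℕ} {ϖm : PreTilt (integerC F) p}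
    (hϖ : ϖm ^ p ^ m = pFlat) {a : Ainf (p := p) F}
    (ha : fontaineTheta (integerC F) p ((WittVector.frobenius : Ainf (p := p) F →+* Ainf (p := p) F)^[m] a) = 0) :
    ∃ b : Ainf (p := p) F, a = (teichmuller p ϖm - (p : Ainf (p := p) F)) * b := by
  obtain ⟨b₀, hb₀⟩ := xi_dvd_of_fontaineTheta_eq_zero ha
  obtain ⟨b, rfl⟩ := (WittVector.frobenius_bijective p (PreTilt (integerC F) p)).surjective.iterate m b₀
  refine ⟨b, (WittVector.frobenius_bijective p (PreTilt (integerC F) p)).injective.iterate m ?_⟩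
  rw [hb₀, iterate_map_mul, frobenius_iterate_teichmuller_sub_natCast hϖ]

/-! ### The two identities around `ω' − p^{pᵐ−1}` -/

omit [CharZero F] [IsAdicComplete (Ideal.span {(p : integerC F)}) (integerC F)] in
set_option maxHeartbeats 1600000 in
set_option synthInstance.maxHeartbeats 400000 in
/-- **`ι([ϖ_m])^{pᵐ} = ι[p♭] = p·ω'`** in `A_max` (`ω' = ξ/p + 1`). [cite: Colmez1998Annals, §III.2] -/
theorem ainfToBmaxPlus_teichmuller_pow {m : ℕ} {ϖm : PreTilt (integerC F) p} (hϖ : ϖm ^ p ^ m = pFlat) :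
    ainfToBmaxPlus F p (teichmuller p ϖm) ^ p ^ m = (p : BmaxPlus F p) * (algebraMap (bmaxZero F p) (BmaxPlus F p) omegaB + 1) := by
  rw [← map_pow, ← map_pow, hϖ, ainfToBmaxPlus, RingHom.comp_apply, ← natCast_mul_omegaB_add_one, map_mul, map_natCast, map_add, map_one]

omit [CharZero F] [IsAdicComplete (Ideal.span {(p : integerC F)}) (integerC F)] in
set_option maxHeartbeats 1600000 in
set_option synthInstance.maxHeartbeats 400000 in
/-- ★ **`p·(ω' − p^{pᵐ−1}) = ι(ξ_m)·ι(Ψ')`** with `Ψ' = Σ_{i<pᵐ} π_m^i p^{pᵐ−1−i}`: the telescoping identity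
`(π_m − p)·Ψ' = π_m^{pᵐ} − p^{pᵐ} = p·ω' − p^{pᵐ}`. [cite: Colmez1998Annals, §III.2] -/
theorem natCast_mul_omegaB_add_one_sub_eq {m : ℕ} {ϖm : PreTilt (integerC F) p} (hϖ : ϖm ^ p ^ m = pFlat) :
    (p : BmaxPlus F p) * (algebraMap (bmaxZero F p) (BmaxPlus F p) omegaB + 1 - (p : BmaxPlus F p) ^ (p ^ m - 1)) =
      ainfToBmaxPlus F p (teichmuller p ϖm - (p : Ainf (p := p) F)) *
        ainfToBmaxPlus F p (∑ i ∈ range (p ^ m), teichmuller p ϖm ^ i * (p : Ainf (p := p) F) ^ (p ^ m - 1 - i)) := by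
  have hM : p ^ m - 1 + 1 = p ^ m := Nat.sub_add_cancel (Nat.one_le_pow _ _ (Fact.out : p.Prime).pos)
  have h1 : (teichmuller p ϖm - (p : Ainf (p := p) F)) * (∑ i ∈ range (p ^ m), teichmuller p ϖm ^ i * (p : Ainf (p := p) F) ^ (p ^ m - 1 - i)) =
      teichmuller p ϖm ^ p ^ m - (p : Ainf (p := p) F) ^ p ^ m := by
    rw [mul_comm]; exact geom_sum₂_mul _ _ _
  rw [← map_mul, h1, map_sub, map_pow, ainfToBmaxPlus_teichmuller_pow hϖ, map_pow, map_natCast]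
  conv_rhs => rw [← hM, pow_succ]
  ring

set_option maxHeartbeats 1600000 in
set_option synthInstance.maxHeartbeats 400000 in
omit [CharZero F] [IsAdicComplete (Ideal.span {(p : integerC F)}) (integerC F)] in
/-- ★ **`ι(π_m)·(ω' − p^{pᵐ−1}) = ι(ξ_m)·Ψ`** with `Ψ = ι(π_m·Σ_{i<pᵐ−1} π_m^i p^{pᵐ−2−i}) + ω' ∈ A_max`: from
`(π_m − p)·Σ_{i<pᵐ−1} π_m^i p^{pᵐ−2−i} = π_m^{pᵐ−1} − p^{pᵐ−1}` and `π_m^{pᵐ} = p·ω'`. The extra factor `π_m = [ϖ_m]` (instead of `p`) is what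
makes this divisibility summable along `m`. [cite: Colmez1998Annals, §III.3] -/
theorem teichmuller_mul_omegaB_add_one_sub_eq {m : ℕ} {ϖm : PreTilt (integerC F) p} (hϖ : ϖm ^ p ^ m = pFlat) :
    ainfToBmaxPlus F p (teichmuller p ϖm) * (algebraMap (bmaxZero F p) (BmaxPlus F p) omegaB + 1 - (p : BmaxPlus F p) ^ (p ^ m - 1)) =
      ainfToBmaxPlus F p (teichmuller p ϖm - (p : Ainf (p := p) F)) *
        (ainfToBmaxPlus F p (teichmuller p ϖm * ∑ i ∈ range (p ^ m - 1), teichmuller p ϖm ^ i * (p : Ainf (p := p) F) ^ (p ^ m - 1 - 1 - i)) +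
          (algebraMap (bmaxZero F p) (BmaxPlus F p) omegaB + 1)) := by
  have hM : p ^ m - 1 + 1 = p ^ m := Nat.sub_add_cancel (Nat.one_le_pow _ _ (Fact.out : p.Prime).pos)
  have h1 : (teichmuller p ϖm - (p : Ainf (p := p) F)) *
      (∑ i ∈ range (p ^ m - 1), teichmuller p ϖm ^ i * (p : Ainf (p := p) F) ^ (p ^ m - 1 - 1 - i)) =
      teichmuller p ϖm ^ (p ^ m - 1) - (p : Ainf (p := p) F) ^ (p ^ m - 1) := by
    rw [mul_comm]; exact geom_sum₂_mul _ _ _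
  have h2 : ainfToBmaxPlus F p (teichmuller p ϖm) * ainfToBmaxPlus F p (teichmuller p ϖm) ^ (p ^ m - 1) =
      (p : BmaxPlus F p) * (algebraMap (bmaxZero F p) (BmaxPlus F p) omegaB + 1) := by
    rw [← pow_succ', hM, ainfToBmaxPlus_teichmuller_pow hϖ]
  have e1 := congrArg (ainfToBmaxPlus F p) h1
  simp only [map_mul, map_sub, map_pow, map_natCast] at e1 ⊢
  linear_combination (-(ainfToBmaxPlus F p (teichmuller p ϖm))) * e1 - h2

set_option maxHeartbeats 1600000 in
set_option synthInstance.maxHeartbeats 400000 in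
/-- **`θ(φᵐ(ω' − p^{pᵐ−1})) = 0`** (multiply by `p`, use the first identity and `θ(φᵐ ξ_m) = θ(ξ) = 0`; `𝒪_{ℂ_F}` is `p`-torsion free).
[cite: Colmez1998Annals, §III.2] -/
theorem thetaBmaxPlus_frobBmaxPlus_iterate_omegaB_add_one_sub {m : ℕ} {ϖm : PreTilt (integerC F) p} (hϖ : ϖm ^ p ^ m = pFlat) :
    thetaBmaxPlus F p ((frobBmaxPlus F p)^[m]
      (algebraMap (bmaxZero F p) (BmaxPlus F p) omegaB + 1 - (p : BmaxPlus F p) ^ (p ^ m - 1))) = 0 := by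
  refine eq_zero_of_natCast_mul_eq_zero (p := p) ?_
  have h := congrArg (fun z => thetaBmaxPlus F p ((frobBmaxPlus F p)^[m] z)) (natCast_mul_omegaB_add_one_sub_eq (F := F) hϖ)
  simp only [iterate_map_mul, map_mul, thetaBmaxPlus_frobBmaxPlus_iterate_xiM hϖ, zero_mul, frobBmaxPlus_iterate_natCast,
    map_natCast] at h
  exact h

/-! ### The kernel of `θ ∘ φᵐ` on `A_max` -/

set_option maxHeartbeats 1600000 in
set_option synthInstance.maxHeartbeats 400000 in
/-- ★ **Structure of `ker(θ∘φᵐ|A_max)`**: if `θ(φᵐ g) = 0` then `g = ι(ξ_m·b) + (ω' − p^{pᵐ−1})·G` for some `b ∈ 𝔸_inf`, `G ∈ A_max`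
(divide with remainder by `ω' − p^{pᵐ−1}`, whose `θ∘φᵐ` vanishes; the remainder lies in `ker(θ∘φᵐ|𝔸_inf) = ξ_m𝔸_inf`).
[cite: Colmez1998Annals, §III.3] -/
theorem exists_eq_of_theta_frobenius_iterate_eq_zero {m : ℕ} {ϖm : PreTilt (integerC F) p} (hϖ : ϖm ^ p ^ m = pFlat)
    {g : BmaxPlus F p} (hg : thetaBmaxPlus F p ((frobBmaxPlus F p)^[m] g) = 0) :
    ∃ (b : Ainf (p := p) F) (G : BmaxPlus F p),
      g = ainfToBmaxPlus F p ((teichmuller p ϖm - (p : Ainf (p := p) F)) * b) +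
        (algebraMap (bmaxZero F p) (BmaxPlus F p) omegaB + 1 - (p : BmaxPlus F p) ^ (p ^ m - 1)) * G := by
  obtain ⟨a, G, haG⟩ := exists_eq_ainf_add_sub_mul g ((p : Ainf (p := p) F) ^ (p ^ m - 1) - 1)
  have e1 : algebraMap (bmaxZero F p) (BmaxPlus F p) omegaB - ainfToBmaxPlus F p ((p : Ainf (p := p) F) ^ (p ^ m - 1) - 1) =
      algebraMap (bmaxZero F p) (BmaxPlus F p) omegaB + 1 - (p : BmaxPlus F p) ^ (p ^ m - 1) := by
    rw [map_sub, map_one, map_pow, map_natCast]; ring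
  rw [e1] at haG
  -- `θ(φᵐ a) = 0`
  have hθa : fontaineTheta (integerC F) p ((WittVector.frobenius : Ainf (p := p) F →+* Ainf (p := p) F)^[m] a) = 0 := by
    have h := congrArg (fun z => thetaBmaxPlus F p ((frobBmaxPlus F p)^[m] z)) haG
    simp only [iterate_map_add, iterate_map_mul, map_add, map_mul, thetaBmaxPlus_frobBmaxPlus_iterate_omegaB_add_one_sub hϖ,
      zero_mul, add_zero, thetaBmaxPlus_frobBmaxPlus_iterate_ainfToBmaxPlus, hg] at h
    exact h.symm
  obtain ⟨b, hb⟩ := exists_eq_xiM_mul_of_fontaineTheta_frobenius_iterate_eq_zero hϖ hθa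
  exact ⟨b, G, by rw [← hb]; exact haG⟩

set_option maxHeartbeats 1600000 in
set_option synthInstance.maxHeartbeats 400000 in
/-- ★ **`p·g ∈ ι(ξ_m)·A_max` for every `g ∈ ker(θ∘φᵐ|A_max)`** (`p·(ω' − p^{pᵐ−1}) = ι(ξ_m)ι(Ψ')`). [cite: Colmez1998Annals, §III.3] -/
theorem exists_natCast_mul_eq_of_theta_frobenius_iterate_eq_zero {m : ℕ} {ϖm : PreTilt (integerC F) p} (hϖ : ϖm ^ p ^ m = pFlat)
    {g : BmaxPlus F p} (hg : thetaBmaxPlus F p ((frobBmaxPlus F p)^[m] g) = 0) :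
    ∃ H : BmaxPlus F p, (p : BmaxPlus F p) * g = ainfToBmaxPlus F p (teichmuller p ϖm - (p : Ainf (p := p) F)) * H := by
  obtain ⟨b, G, h⟩ := exists_eq_of_theta_frobenius_iterate_eq_zero hϖ hg
  refine ⟨(p : BmaxPlus F p) * ainfToBmaxPlus F p b +
    ainfToBmaxPlus F p (∑ i ∈ range (p ^ m), teichmuller p ϖm ^ i * (p : Ainf (p := p) F) ^ (p ^ m - 1 - i)) * G, ?_⟩
  have e := natCast_mul_omegaB_add_one_sub_eq (F := F) hϖ
  rw [h, map_mul]
  linear_combination G * e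

set_option maxHeartbeats 1600000 in
set_option synthInstance.maxHeartbeats 400000 in
/-- ★ **`ι(π_m)·g ∈ ι(ξ_m)·A_max` for every `g ∈ ker(θ∘φᵐ|A_max)`**, `π_m = [ϖ_m]` (`ι(π_m)·(ω' − p^{pᵐ−1}) = ι(ξ_m)·Ψ`): the sharp
integrality of the division by `ξ_m` in `A_max` (losing only `[ϖ^{1/pᵐ}]`, of valuation `1/pᵐ`). [cite: Colmez1998Annals, §III.3] -/
theorem exists_teichmuller_mul_eq_of_theta_frobenius_iterate_eq_zero {m : ℕ} {ϖm : PreTilt (integerC F) p} (hϖ : ϖm ^ p ^ m = pFlat)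
    {g : BmaxPlus F p} (hg : thetaBmaxPlus F p ((frobBmaxPlus F p)^[m] g) = 0) :
    ∃ h : BmaxPlus F p, ainfToBmaxPlus F p (teichmuller p ϖm) * g = ainfToBmaxPlus F p (teichmuller p ϖm - (p : Ainf (p := p) F)) * h := by
  obtain ⟨b, G, h⟩ := exists_eq_of_theta_frobenius_iterate_eq_zero hϖ hg
  refine ⟨ainfToBmaxPlus F p (teichmuller p ϖm) * ainfToBmaxPlus F p b +
    (ainfToBmaxPlus F p (teichmuller p ϖm * ∑ i ∈ range (p ^ m - 1), teichmuller p ϖm ^ i * (p : Ainf (p := p) F) ^ (p ^ m - 1 - 1 - i)) +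
      (algebraMap (bmaxZero F p) (BmaxPlus F p) omegaB + 1)) * G, ?_⟩
  have e := teichmuller_mul_omegaB_add_one_sub_eq (F := F) hϖ
  rw [h, map_mul]
  linear_combination G * e

end Literature.NumberTheory.PAdicHodge

end
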